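import Summits.Ventures.HodgeRepro2.T5SU11RadialGreen

/-!
# Green's identity for the inhomogeneous radial equation on `[ε, R] ⊂ (0, ∞)`

For `u` solving the INHOMOGENEOUS radial equation `sinh 2t · u″ + 2 cosh 2t · u′ = μ sinh 2t · u + sinh 2t · f` and
`v` solving the homogeneous one `sinh 2t · v″ + 2 cosh 2t · v′ = μ′ sinh 2t · v` on `(0, ∞)`, the bracket
`W = sinh 2t · (v u′ − u v′)` has the derivative

  **`W′ = f v sinh 2t + (μ − μ′) u v sinh 2t`**  (`hasDerivAt_green_bracket`),

so that on every `[ε, R] ⊂ (0, ∞)`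

  **`∫_ε^R f v sinh 2t = W(R) − W(ε) + (μ′ − μ) ∫_ε^R u v sinh 2t`**  (`green_identity_inhom`).

Applied to `u = G_λ f` (rows 451–452) and `v = φ_{λ′}` this is the first step of the diagonalisation of the
resolvent by the spherical transform (the boundary terms are treated in the following rows). Nothing is claimed
about (N).

Blind lane: Mathlib + the HodgeRepro2 prefix only; no sorry; axioms ⊆ {propext, Classical.choice,
Quot.sound}.
-/

namespace Summit.Ventures.HodgeRepro2.T5SU11GreenIdentityInhomogeneous

open MeasureTheory intervalIntegral
open Set (Ioi uIcc)
open T5SU11ReductionOfOrder T5SU11SphericalLegendreHigher T5SU11RadialGreen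

section

variable {μ μ' : ℝ} {u u' u'' v v' v'' f : ℝ → ℝ}
  (hu : ∀ t, 0 < t → HasDerivAt u (u' t) t) (hu' : ∀ t, 0 < t → HasDerivAt u' (u'' t) t)
  (huode : ∀ t, 0 < t → Real.sinh (2 * t) * u'' t + 2 * Real.cosh (2 * t) * u' t
    = μ * Real.sinh (2 * t) * u t + Real.sinh (2 * t) * f t)
  (hv : ∀ t, 0 < t → HasDerivAt v (v' t) t) (hv' : ∀ t, 0 < t → HasDerivAt v' (v'' t) t)
  (hvode : ∀ t, 0 < t → Real.sinh (2 * t) * v'' t + 2 * Real.cosh (2 * t) * v' t = μ' * Real.sinh (2 * t) * v t)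
  (hf : ContinuousOn f (Ioi 0))

include hu hu' huode hv hv' hvode in
/-- **`W′ = f v sinh 2t + (μ − μ′) u v sinh 2t`** for the bracket `W = sinh 2t · (v u′ − u v′)`. -/
theorem hasDerivAt_green_bracket {t : ℝ} (ht : 0 < t) :
    HasDerivAt (fun t => Real.sinh (2 * t) * (v t * u' t - u t * v' t))
      (f t * v t * Real.sinh (2 * t) + (μ - μ') * (u t * v t * Real.sinh (2 * t))) t := by
  have h := (hasDerivAt_sinh_two_mul_self t).mul
    (((hv t ht).mul (hu' t ht)).sub ((hu t ht).mul (hv' t ht)))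
  refine h.congr_deriv ?_
  simp only [Pi.sub_apply, Pi.mul_apply]
  have e1 := huode t ht
  have e2 := hvode t ht
  linear_combination (v t) * e1 - (u t) * e2

include hu hu' huode hv hv' hvode hf in
/-- **Green's identity on `[ε, R] ⊂ (0, ∞)`**:
`∫_ε^R f v sinh 2t = W(R) − W(ε) + (μ′ − μ) ∫_ε^R u v sinh 2t`, `W = sinh 2t · (v u′ − u v′)`. -/
theorem green_identity_inhom {ε R : ℝ} (hε : 0 < ε) (hεR : ε ≤ R) :
    ∫ t in ε..R, f t * v t * Real.sinh (2 * t)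
      = (Real.sinh (2 * R) * (v R * u' R - u R * v' R) - Real.sinh (2 * ε) * (v ε * u' ε - u ε * v' ε))
        + (μ' - μ) * ∫ t in ε..R, u t * v t * Real.sinh (2 * t) := by
  have hR : 0 < R := lt_of_lt_of_le hε hεR
  have hsub : uIcc ε R ⊆ Ioi 0 := uIcc_subset_Ioi hε hR
  -- continuity of the pieces on `(0, ∞)`
  have hcu : ContinuousOn u (Ioi 0) := fun t ht => (hu t ht).continuousAt.continuousWithinAt
  have hcv : ContinuousOn v (Ioi 0) := fun t ht => (hv t ht).continuousAt.continuousWithinAt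
  have hcs : ContinuousOn (fun t => Real.sinh (2 * t)) (Ioi 0) :=
    (Real.continuous_sinh.comp (continuous_const.mul continuous_id)).continuousOn
  have hi1 : IntervalIntegrable (fun t => f t * v t * Real.sinh (2 * t)) volume ε R :=
    (((hf.mul hcv).mul hcs).mono hsub).intervalIntegrable
  have hi2 : IntervalIntegrable (fun t => u t * v t * Real.sinh (2 * t)) volume ε R :=
    (((hcu.mul hcv).mul hcs).mono hsub).intervalIntegrable
  -- the fundamental theorem of calculus for the bracket
  have hftc := integral_eq_sub_of_hasDerivAt
    (f := fun t => Real.sinh (2 * t) * (v t * u' t - u t * v' t))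
    (f' := fun t => f t * v t * Real.sinh (2 * t) + (μ - μ') * (u t * v t * Real.sinh (2 * t)))
    (fun t ht => hasDerivAt_green_bracket hu hu' huode hv hv' hvode (hsub ht))
    (hi1.add (hi2.const_mul _))
  rw [integral_add hi1 (hi2.const_mul _), intervalIntegral.integral_const_mul] at hftc
  linear_combination hftc

end

end Summit.Ventures.HodgeRepro2.T5SU11GreenIdentityInhomogeneous
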